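import Literature.Geometry.Kaehler.ManifoldForms
import Literature.NumberTheory.Transcendental.FormIntegrationCharts
import HarnessLib

/-!
# Differential forms on manifolds: the chart calculus of `d` (vector-valued, with corners)

Trunk: Kähler / Hodge, support for the finite-dimensionality of de Rham cohomology
(`Literature.AlgebraicGeometry.Motives.finite_deRhamCohomology`).

`Literature.Geometry.Kaehler.ManifoldForms` defines the exterior derivative `mextDeriv α` of a form
on a manifold chart-wise (at `x`, Mathlib's `extDerivWithin` of the chart representative
`α.inChart x` at the centre of the preferred chart at `x`) and records the chart-independence of
this recipe as the *named fact* `Literature.Geometry.Kaehler.inChart_mextDeriv`. This file proves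
that fact (`inChart_mextDeriv_holds`) and the surrounding local calculus, for forms with values
in an arbitrary real normed space `F` and for every model with corners `I` (all statements are
"within `range I`"):

* `MForm.SmoothAt α x`: smoothness of a form at a point (so that `IsSmoothForm α ↔ ∀ x, SmoothAt`);
* locality: forms that agree near `z` have the same chart germs, smoothness and `d` at `z`;
* the change-of-chart identity `MForm.inChart_eq_of_mem_target` / `MForm.inChart_eq_comp_inChart`:
  `α.inChart x₀ = τ^*(α.inChart x₁)` with `τ = extChartAt I x₁ ∘ (extChartAt I x₀).symm`, whose
  derivative within `range I` is Mathlib's `tangentCoordChange I x₀ x₁`;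
* `inChart_mextDeriv_of_mem_target`: on the WHOLE target of the chart at `x₀`,
  `(dα).inChart x₀ y = extDerivWithin (α.inChart x₀) (range I) y` at every point over which `α`
  is smooth (Mathlib's `extDerivWithin_pullback` along `τ`), hence the named fact (its germ at
  the centre), smoothness of `dα` at `x` from smoothness of `α` near `x`, and `d (d α) x = 0`;
* transport of smoothness between charts (`MForm.SmoothAt.contDiffWithinAt_inChart` and its
  converse `MForm.smoothAt_of_contDiffWithinAt_inChart`).

## Relation to `Literature.NumberTheory.Transcendental.FormIntegrationCharts`

That file (integration of top forms) already proves the **real-valued** (`F = ℝ`) versions of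
part of this calculus, some of them for boundaryless `I` only; the present statements are their
generalisations to vector-valued forms and models with corners, from which a librarian may later
re-derive them:
`mfderivWithin_extChartAt_symm_apply_eq` (≈ `mfderivWithin_extChartAt_symm_eq_tangentCoordChange`,
here stated at a point of the chart target), `MForm.inChart_apply_extChartAt` /
`MForm.inChart_extChartAt_eq_comp` (≈ `MForm.inChart_eq_of_mem_target` /
`MForm.inChart_eq_comp_inChart`), `mextDeriv_apply_eq_extDeriv` (boundaryless;
≈ `mextDeriv_eq_extDerivWithin`), `MForm.inChart_eventuallyEq_pullback` and
`IsSmoothForm.contDiffOn_inChart` (boundaryless; ≈ the smoothness transport). The smoothness of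
pull-backs of alternating maps along linear maps
(`Literature.NumberTheory.Transcendental.ContDiffWithinAt.continuousAlternatingMapCompContinuousLinearMap`,
via `alternatizationCLM`) is imported from there. New here: the `F`-valued / with-corners
setting, `SmoothAt` and locality, the whole-chart formula for `(dα).inChart`, the discharge of
the named fact, and the local `d ∘ d = 0`.

## References

* F. W. Warner, *Foundations of Differentiable Manifolds and Lie Groups*, GTM 94 (1983), 2.20–2.23
  (local formula and naturality of `d`).
* J. M. Lee, *Introduction to Smooth Manifolds*, 2nd ed., GTM 218 (2013), Lemma 14.16,
  Prop. 14.26.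
-/

noncomputable section

open scoped Manifold ContDiff Topology
open Bundle Set Filter

namespace Literature.Geometry.Kaehler

/-! ### Smoothness of a form at a point; locality -/

variable {E : Type*} [NormedAddCommGroup E] [NormedSpace ℝ E]
  {H : Type*} [TopologicalSpace H] {I : ModelWithCorners ℝ E H}
  {M : Type*} [TopologicalSpace M] [ChartedSpace H M]
  {F : Type*} [NormedAddCommGroup F] [NormedSpace ℝ F] {k : ℕ}

/-- A form `α` is *smooth at* `x` if its representative in the preferred chart at `x` is `C^∞`
within `range I` at the centre `extChartAt I x x`; `IsSmoothForm α` is `∀ x, α.SmoothAt x`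
(`isSmoothForm_iff_smoothAt`). Warner (1983), Def. 2.15. [cite: WarnerGTM94, Def. 2.15] -/
def MForm.SmoothAt (α : MForm I M F k) (x : M) : Prop :=
  ContDiffWithinAt ℝ ∞ (α.inChart x) (range I) (extChartAt I x x)

/-- `IsSmoothForm` is smoothness at every point (definitional). [folklore] -/
theorem isSmoothForm_iff_smoothAt (α : MForm I M F k) : IsSmoothForm α ↔ ∀ x, α.SmoothAt x :=
  Iff.rfl

/-- The zero form is smooth at every point. [folklore] -/
theorem MForm.smoothAt_zero (x : M) : (0 : MForm I M F k).SmoothAt x := by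
  rw [MForm.SmoothAt, MForm.inChart_zero]
  exact contDiffWithinAt_const (c := 0)

/-- Smoothness at a point is preserved by sums. [folklore] -/
theorem MForm.SmoothAt.add {α β : MForm I M F k} {x : M} (hα : α.SmoothAt x) (hβ : β.SmoothAt x) :
    (α + β).SmoothAt x := by
  rw [MForm.SmoothAt, MForm.inChart_add]
  exact ContDiffWithinAt.add hα hβ

/-- Smoothness at a point is preserved by negation. [folklore] -/
theorem MForm.SmoothAt.neg {α : MForm I M F k} {x : M} (hα : α.SmoothAt x) : (-α).SmoothAt x := by
  have h : (-α) = (-1 : ℝ) • α := by simp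
  rw [h, MForm.SmoothAt, MForm.inChart_smul]
  exact hα.const_smul (-1 : ℝ)

/-- Smoothness at a point is preserved by differences. [folklore] -/
theorem MForm.SmoothAt.sub {α β : MForm I M F k} {x : M} (hα : α.SmoothAt x) (hβ : β.SmoothAt x) :
    (α - β).SmoothAt x := by
  rw [sub_eq_add_neg]
  exact hα.add hβ.neg

/-- Smoothness at a point is preserved by scalar multiplication. [folklore] -/
theorem MForm.SmoothAt.smul (c : ℝ) {α : MForm I M F k} {x : M} (hα : α.SmoothAt x) :
    (c • α).SmoothAt x := by
  rw [MForm.SmoothAt, MForm.inChart_smul]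
  exact hα.const_smul c

/-- **Locality of the chart representative.** If two forms agree near a point `z` of the source
of the chart at `x₀`, their representatives in that chart agree near `extChartAt I x₀ z`.
[folklore] -/
theorem MForm.inChart_eventuallyEq {α β : MForm I M F k} {x₀ z : M}
    (hz : z ∈ (extChartAt I x₀).source) (h : ∀ᶠ w in 𝓝 z, α w = β w) :
    α.inChart x₀ =ᶠ[𝓝 (extChartAt I x₀ z)] β.inChart x₀ := by
  have hc : ContinuousAt (extChartAt I x₀).symm (extChartAt I x₀ z) :=
    continuousAt_extChartAt_symm' hz
  have h'' : ∀ᶠ w in 𝓝 ((extChartAt I x₀).symm (extChartAt I x₀ z)), α w = β w := by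
    rwa [(extChartAt I x₀).left_inv hz]
  have h' : ∀ᶠ y in 𝓝 (extChartAt I x₀ z), α ((extChartAt I x₀).symm y) =
      β ((extChartAt I x₀).symm y) := hc.tendsto.eventually h''
  filter_upwards [h'] with y hy
  simp only [MForm.inChart]
  rw [hy]

/-- Forms that agree near `z` are simultaneously smooth at `z`. [folklore] -/
theorem MForm.SmoothAt.congr_of_eventuallyEq {α β : MForm I M F k} {z : M} (hα : α.SmoothAt z)
    (h : ∀ᶠ w in 𝓝 z, α w = β w) : β.SmoothAt z := by
  have h' := MForm.inChart_eventuallyEq (mem_extChartAt_source (I := I) z) h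
  exact ContDiffWithinAt.congr_of_eventuallyEq hα (h'.symm.filter_mono nhdsWithin_le_nhds)
    h'.self_of_nhds.symm

/-- Smoothness at `z` depends only on the germ of the form at `z`. [folklore] -/
theorem MForm.smoothAt_congr_of_eventuallyEq {α β : MForm I M F k} {z : M}
    (h : ∀ᶠ w in 𝓝 z, α w = β w) : α.SmoothAt z ↔ β.SmoothAt z :=
  ⟨fun hα ↦ hα.congr_of_eventuallyEq h,
    fun hβ ↦ hβ.congr_of_eventuallyEq (h.mono fun _ hw ↦ hw.symm)⟩

/-- **Locality of `d`.** Forms that agree near `z` have the same exterior derivative at `z`.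
[folklore] -/
theorem mextDeriv_congr_of_eventuallyEq {α β : MForm I M F k} {z : M}
    (h : ∀ᶠ w in 𝓝 z, α w = β w) : mextDeriv α z = mextDeriv β z := by
  have h' := MForm.inChart_eventuallyEq (mem_extChartAt_source (I := I) z) h
  simp only [mextDeriv]
  rw [(h'.filter_mono nhdsWithin_le_nhds).extDerivWithin_eq h'.self_of_nhds]

/-- Locality of `d`, germ form: forms that agree near `z` have exterior derivatives that agree
near `z`. [folklore] -/
theorem mextDeriv_eventuallyEq_of_eventuallyEq {α β : MForm I M F k} {z : M}
    (h : ∀ᶠ w in 𝓝 z, α w = β w) : ∀ᶠ w in 𝓝 z, mextDeriv α w = mextDeriv β w := by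
  filter_upwards [h.eventually_nhds] with w hw
  exact mextDeriv_congr_of_eventuallyEq hw

/-! ### Change of chart -/

section Chart

variable [IsManifold I ∞ M]

/-- The derivative within `range I` of the inverse extended chart at `x₀`, at a point `y` of its
target, is the tangent coordinate change from the chart at `x₀` to the chart at
`z = (extChartAt I x₀).symm y`, taken at `z` (both are the derivative of
`extChartAt I z ∘ (extChartAt I x₀).symm`). [folklore] -/
theorem mfderivWithin_extChartAt_symm_eq_tangentCoordChange {x₀ : M} {y : E}
    (hy : y ∈ (extChartAt I x₀).target) :
    mfderivWithin 𝓘(ℝ, E) I (extChartAt I x₀).symm (range I) y =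
      tangentCoordChange I x₀ ((extChartAt I x₀).symm y) ((extChartAt I x₀).symm y) := by
  rw [(mdifferentiableWithinAt_extChartAt_symm hy).mfderivWithin, tangentCoordChange_def,
    (extChartAt I x₀).right_inv hy]
  simp only [writtenInExtChartAt, extChartAt_model_space_eq_id, PartialEquiv.refl_symm,
    PartialEquiv.refl_coe, ModelWithCorners.range_eq_univ, Set.preimage_id, Set.inter_univ,
    Function.comp_id, id_eq]

/-- **The chart representative in terms of the tangent coordinate change**: at a point `y` of the
target of the chart at `x₀`, with `z = (extChartAt I x₀).symm y`,
`α.inChart x₀ y = α z ∘ (tangentCoordChange I x₀ z z)`. [folklore] -/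
theorem MForm.inChart_eq_of_mem_target (α : MForm I M F k) {x₀ : M} {y : E}
    (hy : y ∈ (extChartAt I x₀).target) :
    α.inChart x₀ y = (α ((extChartAt I x₀).symm y)).compContinuousLinearMap
      (tangentCoordChange I x₀ ((extChartAt I x₀).symm y) ((extChartAt I x₀).symm y) :) := by
  simp only [MForm.inChart, mfderivWithin_extChartAt_symm_eq_tangentCoordChange hy]

/-- The chart representative at the centre of the chart is the form itself:
`α.inChart x x' = α x` at `x' = extChartAt I x x`. [folklore] -/
theorem MForm.inChart_apply_self (α : MForm I M F k) (x : M) :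
    α.inChart x (extChartAt I x x) = α x := by
  rw [α.inChart_eq_of_mem_target (mem_extChartAt_target (I := I) x), extChartAt_to_inv (I := I) x]
  ext v
  simp only [ContinuousAlternatingMap.compContinuousLinearMap_apply, Function.comp_def]
  have h : ∀ w : E, tangentCoordChange I x x x w = w := fun w ↦
    tangentCoordChange_self (mem_extChartAt_source x)
  exact congrArg (α x) (funext fun i ↦ h (v i))

/-- **Change of chart for the representative of a form**: for `y` in the target of the chart at
`x₀` with `z = (extChartAt I x₀).symm y` in the source of the chart at `x₁`,
`α.inChart x₀ y = (α.inChart x₁ (extChartAt I x₁ z)) ∘ tangentCoordChange I x₀ x₁ z`, i.e.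
`α.inChart x₀` is the pull-back of `α.inChart x₁` along the transition map
`extChartAt I x₁ ∘ (extChartAt I x₀).symm` (cocycle property `tangentCoordChange_comp`).
Warner (1983), 2.18 / 2.22. [cite: WarnerGTM94, 2.22] -/
theorem MForm.inChart_eq_comp_inChart (α : MForm I M F k) {x₀ x₁ : M} {y : E}
    (hy : y ∈ (extChartAt I x₀).target) (h₁ : (extChartAt I x₀).symm y ∈ (extChartAt I x₁).source) :
    α.inChart x₀ y =
      (α.inChart x₁ (extChartAt I x₁ ((extChartAt I x₀).symm y))).compContinuousLinearMap
      (tangentCoordChange I x₀ x₁ ((extChartAt I x₀).symm y)) := by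
  set z := (extChartAt I x₀).symm y with hz
  have hzz : (extChartAt I x₁).symm (extChartAt I x₁ z) = z := (extChartAt I x₁).left_inv h₁
  rw [α.inChart_eq_of_mem_target hy, α.inChart_eq_of_mem_target ((extChartAt I x₁).map_source h₁),
    ← hz, hzz]
  ext v
  simp only [ContinuousAlternatingMap.compContinuousLinearMap_apply, Function.comp_def]
  congr 1
  funext i
  refine (tangentCoordChange_comp ⟨⟨?_, h₁⟩, mem_extChartAt_source z⟩).symm
  rw [hz]
  exact (extChartAt I x₀).map_target hy

/-- **The exterior derivative in the chart at the point**: `dα x` *is* Mathlib's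
`extDerivWithin` of the representative `α.inChart x` at the centre of the chart at `x`
(the pull-back factor `mfderiv (extChartAt I x) x` in the definition of `mextDeriv` is the
identity, `mfderiv_extChartAt_self`). [folklore] -/
theorem mextDeriv_eq_extDerivWithin (α : MForm I M F k) (x : M) :
    mextDeriv α x = extDerivWithin (α.inChart x) (range I) (extChartAt I x x) := by
  simp only [mextDeriv, mfderiv_extChartAt_self]
  ext v
  rfl

/-- **Chart formula for `d` on the whole chart.** For every point `y` of the target of the chart
at `x₀` over which `α` is smooth, the representative of `dα` in that chart at `y` is the exterior
derivative (within `range I`) of the representative of `α`: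
`(dα).inChart x₀ y = extDerivWithin (α.inChart x₀) (range I) y`. Proof: by the change of chart
`α.inChart x₀ = τ^*(α.inChart z)` near `y` (`τ` the transition map to the chart at
`z = (extChartAt I x₀).symm y`) and Mathlib's naturality `extDerivWithin_pullback`.
Warner (1983), 2.20(d) / Prop. 2.23; Lee (2013), Prop. 14.26. [cite: WarnerGTM94, Prop. 2.23] -/
theorem inChart_mextDeriv_of_mem_target (α : MForm I M F k) {x₀ : M} {y : E}
    (hy : y ∈ (extChartAt I x₀).target) (hα : α.SmoothAt ((extChartAt I x₀).symm y)) :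
    (mextDeriv α).inChart x₀ y = extDerivWithin (α.inChart x₀) (range I) y := by
  set z := (extChartAt I x₀).symm y with hz
  have hzs : z ∈ (extChartAt I x₀).source := (extChartAt I x₀).map_target hy
  have hyz : extChartAt I x₀ z = y := (extChartAt I x₀).right_inv hy
  have hyI : y ∈ range I := extChartAt_target_subset_range x₀ hy
  -- the transition map to the chart at `z`
  set τ : E → E := extChartAt I z ∘ (extChartAt I x₀).symm with hτ
  have hτy : τ y = extChartAt I z z := by
    show extChartAt I z ((extChartAt I x₀).symm y) = _
    rw [← hz]
  have hτ_smooth : ContDiffWithinAt ℝ ∞ τ (range I) y := by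
    refine contDiffWithinAt_ext_coord_change z x₀ ?_
    rw [PartialEquiv.trans_source, PartialEquiv.symm_source, mem_inter_iff, mem_preimage]
    exact ⟨hy, by rw [← hz]; exact mem_extChartAt_source z⟩
  have hmaps : MapsTo τ (range I) (range I) := fun w _ ↦ by
    simp only [hτ, Function.comp_apply, extChartAt_coe]
    exact mem_range_self _
  -- `α.inChart x₀` is the pull-back of `α.inChart z` along `τ`, near `y` within `range I`
  have hev : α.inChart x₀ =ᶠ[𝓝[range I] y]
      fun w ↦ (α.inChart z (τ w)).compContinuousLinearMap (fderivWithin ℝ τ (range I) w) := by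
    have h1 : ∀ᶠ w in 𝓝[range I] y, w ∈ (extChartAt I x₀).target :=
      extChartAt_target_mem_nhdsWithin_of_mem hy
    have h2 : ∀ᶠ w in 𝓝[range I] y, (extChartAt I x₀).symm w ∈ (extChartAt I z).source := by
      refine eventually_nhdsWithin_of_eventually_nhds ?_
      refine (continuousAt_extChartAt_symm'' hy).eventually ?_
      rw [← hz]
      exact extChartAt_source_mem_nhds z
    filter_upwards [h1, h2] with w hw1 hw2
    rw [α.inChart_eq_comp_inChart hw1 hw2, tangentCoordChange_def, (extChartAt I x₀).right_inv hw1]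
    rfl
  have hfd : fderivWithin ℝ τ (range I) y = tangentCoordChange I x₀ z z := by
    rw [tangentCoordChange_def, hyz]
  -- left-hand side
  rw [(mextDeriv α).inChart_eq_of_mem_target hy, ← hz, mextDeriv_eq_extDerivWithin, ← hfd, ← hτy]
  -- right-hand side: naturality of `extDerivWithin`
  rw [hev.extDerivWithin_eq_of_mem hyI]
  have hω : DifferentiableWithinAt ℝ (α.inChart z) (range I) (τ y) := by
    rw [hτy]
    exact hα.differentiableWithinAt (by simp)
  have hr : minSmoothness ℝ 2 ≤ ∞ := by
    rw [minSmoothness_of_isRCLikeNormedField]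
    exact WithTop.coe_le_coe.2 le_top
  exact (extDerivWithin_pullback hω hτ_smooth hr I.uniqueDiffOn
    (I.range_subset_closure_interior hyI) hyI hmaps).symm

omit [IsManifold I ∞ M] in
variable (I M F) in
/-- **Discharge of the named fact `Literature.Geometry.Kaehler.inChart_mextDeriv`** (chart
independence of `d` at the centre of each chart, Warner (1983), Prop. 2.23): the germ at the
centre of the whole-chart formula `inChart_mextDeriv_of_mem_target`.
[cite: WarnerGTM94, Prop. 2.23] -/
theorem inChart_mextDeriv_holds : inChart_mextDeriv I M F := by
  intro _ k α hα x₀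
  filter_upwards [extChartAt_target_mem_nhdsWithin x₀] with y hy
  exact inChart_mextDeriv_of_mem_target α hy (hα _)

/-- **Transport of smoothness between charts.** If `z` lies in the sources of the charts at `x₀`
and at `x₁` and the representative of `α` in the chart at `x₁` is `C^∞` within `range I` at the
image of `z`, then so is its representative in the chart at `x₀` (the two are related by
pull-back along the `C^∞` transition map). [folklore] -/
theorem MForm.contDiffWithinAt_inChart_of_contDiffWithinAt_inChart (α : MForm I M F k)
    {x₀ x₁ z : M} (h₀ : z ∈ (extChartAt I x₀).source) (h₁ : z ∈ (extChartAt I x₁).source)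
    (h : ContDiffWithinAt ℝ ∞ (α.inChart x₁) (range I) (extChartAt I x₁ z)) :
    ContDiffWithinAt ℝ ∞ (α.inChart x₀) (range I) (extChartAt I x₀ z) := by
  set y := extChartAt I x₀ z with hy'
  have hy : y ∈ (extChartAt I x₀).target := (extChartAt I x₀).map_source h₀
  have hzy : (extChartAt I x₀).symm y = z := (extChartAt I x₀).left_inv h₀
  have hyI : y ∈ range I := extChartAt_target_subset_range x₀ hy
  set τ : E → E := extChartAt I x₁ ∘ (extChartAt I x₀).symm with hτ
  have hτy : τ y = extChartAt I x₁ z := by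
    show extChartAt I x₁ ((extChartAt I x₀).symm y) = _
    rw [hzy]
  have hτ_smooth : ContDiffWithinAt ℝ ∞ τ (range I) y := by
    refine contDiffWithinAt_ext_coord_change x₁ x₀ ?_
    rw [PartialEquiv.trans_source, PartialEquiv.symm_source, mem_inter_iff, mem_preimage]
    exact ⟨hy, by rw [hzy]; exact h₁⟩
  have hmaps : MapsTo τ (range I) (range I) := fun w _ ↦ by
    simp only [hτ, Function.comp_apply, extChartAt_coe]
    exact mem_range_self _
  have hev : α.inChart x₀ =ᶠ[𝓝[range I] y]
      fun w ↦ (α.inChart x₁ (τ w)).compContinuousLinearMap (fderivWithin ℝ τ (range I) w) := by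
    have h1 : ∀ᶠ w in 𝓝[range I] y, w ∈ (extChartAt I x₀).target :=
      extChartAt_target_mem_nhdsWithin_of_mem hy
    have h2 : ∀ᶠ w in 𝓝[range I] y, (extChartAt I x₀).symm w ∈ (extChartAt I x₁).source := by
      refine eventually_nhdsWithin_of_eventually_nhds ?_
      refine (continuousAt_extChartAt_symm'' hy).eventually ?_
      rw [hzy]
      exact extChartAt_source_mem_nhds' h₁
    filter_upwards [h1, h2] with w hw1 hw2
    rw [α.inChart_eq_comp_inChart hw1 hw2, tangentCoordChange_def, (extChartAt I x₀).right_inv hw1]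
    rfl
  have hsm : ContDiffWithinAt ℝ ∞
      (fun w ↦ (α.inChart x₁ (τ w)).compContinuousLinearMap (fderivWithin ℝ τ (range I) w))
      (range I) y := by
    refine
      Literature.NumberTheory.Transcendental.ContDiffWithinAt.continuousAlternatingMapCompContinuousLinearMap
      ?_ ?_
    · exact ContDiffWithinAt.comp (t := range I) y (by rw [hτy]; exact h) hτ_smooth hmaps
    · exact hτ_smooth.fderivWithin_right I.uniqueDiffOn (by simp) hyI
  exact hsm.congr_of_eventuallyEq hev (hev.self_of_nhdsWithin hyI)

/-- A form smooth at a point `z` of the source of the chart at `x₀` has a `C^∞` representative in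
that chart at the image of `z`. [folklore] -/
theorem MForm.SmoothAt.contDiffWithinAt_inChart {α : MForm I M F k} {x₀ z : M}
    (hz : z ∈ (extChartAt I x₀).source) (hα : α.SmoothAt z) :
    ContDiffWithinAt ℝ ∞ (α.inChart x₀) (range I) (extChartAt I x₀ z) :=
  α.contDiffWithinAt_inChart_of_contDiffWithinAt_inChart hz (mem_extChartAt_source z) hα

/-- Conversely, a form whose representative in the chart at `x₀` is `C^∞` at the image of a point
`z` of the source is smooth at `z`. [folklore] -/
theorem MForm.smoothAt_of_contDiffWithinAt_inChart {α : MForm I M F k} {x₀ z : M}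
    (hz : z ∈ (extChartAt I x₀).source)
    (h : ContDiffWithinAt ℝ ∞ (α.inChart x₀) (range I) (extChartAt I x₀ z)) : α.SmoothAt z :=
  α.contDiffWithinAt_inChart_of_contDiffWithinAt_inChart (mem_extChartAt_source z) hz h

/-- Smoothness at the points of the source of a chart is `C^∞`-regularity of the representative
in that chart at their images. [folklore] -/
theorem MForm.smoothAt_iff_contDiffWithinAt_inChart {α : MForm I M F k} {x₀ z : M}
    (hz : z ∈ (extChartAt I x₀).source) :
    α.SmoothAt z ↔ ContDiffWithinAt ℝ ∞ (α.inChart x₀) (range I) (extChartAt I x₀ z) :=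
  ⟨fun h ↦ h.contDiffWithinAt_inChart hz, fun h ↦ MForm.smoothAt_of_contDiffWithinAt_inChart hz h⟩

/-! ### Local smoothness of `dα` and `d ∘ d = 0` -/

/-- If `α` is smooth near `x`, the representative of `dα` in the chart at `x` agrees, near the
centre within `range I`, with `extDerivWithin` of the representative of `α`. [folklore] -/
theorem inChart_mextDeriv_eventuallyEq {α : MForm I M F k} {x : M} (h : ∀ᶠ z in 𝓝 x, α.SmoothAt z) :
    (mextDeriv α).inChart x =ᶠ[𝓝[range I] (extChartAt I x x)]
      extDerivWithin (α.inChart x) (range I) := by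
  have h1 : ∀ᶠ y in 𝓝[range I] (extChartAt I x x), y ∈ (extChartAt I x).target :=
    extChartAt_target_mem_nhdsWithin x
  have h2 : ∀ᶠ y in 𝓝[range I] (extChartAt I x x), α.SmoothAt ((extChartAt I x).symm y) := by
    refine eventually_nhdsWithin_of_eventually_nhds ?_
    refine (continuousAt_extChartAt_symm x).eventually ?_
    rwa [extChartAt_to_inv]
  filter_upwards [h1, h2] with y hy1 hy2
  exact inChart_mextDeriv_of_mem_target α hy1 hy2

/-- **`dα` is smooth at `x` if `α` is smooth near `x`** (Warner (1983), Thm. 2.20), local form of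
`isSmoothForm_mextDeriv`. [cite: WarnerGTM94, Thm. 2.20] -/
theorem MForm.SmoothAt.mextDeriv {α : MForm I M F k} {x : M} (h : ∀ᶠ z in 𝓝 x, α.SmoothAt z) :
    (mextDeriv α).SmoothAt x := by
  have hc : extChartAt I x x ∈ range I := mem_range_self _
  have hx : α.SmoothAt x := h.self_of_nhds
  have h2 : ContDiffWithinAt ℝ ∞ (extDerivWithin (α.inChart x) (range I)) (range I)
      (extChartAt I x x) := by
    have hf := hx.fderivWithin_right (m := ∞) I.uniqueDiffOn (by simp) hc
    exact (ContinuousAlternatingMap.alternatizeUncurryFinCLM ℝ E F).contDiff.comp_contDiffWithinAt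
      hf
  have hev := inChart_mextDeriv_eventuallyEq h
  exact h2.congr_of_eventuallyEq hev (hev.self_of_nhdsWithin hc)

/-- **`d (dα) = 0` at `x` if `α` is smooth near `x`** (Warner (1983), Thm. 2.20(3)), local form
of `mextDeriv_mextDeriv`. [cite: WarnerGTM94, Thm. 2.20] -/
theorem mextDeriv_mextDeriv_of_smoothAt {α : MForm I M F k} {x : M}
    (h : ∀ᶠ z in 𝓝 x, α.SmoothAt z) : mextDeriv (mextDeriv α) x = 0 := by
  have hc : extChartAt I x x ∈ range I := mem_range_self _
  have hr : minSmoothness ℝ 2 ≤ ∞ := by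
    rw [minSmoothness_of_isRCLikeNormedField]
    exact WithTop.coe_le_coe.2 le_top
  rw [mextDeriv_eq_extDerivWithin, (inChart_mextDeriv_eventuallyEq h).extDerivWithin_eq_of_mem hc,
    extDerivWithin_extDerivWithin_apply h.self_of_nhds hr I.uniqueDiffOn
      (I.range_subset_closure_interior hc) hc]
  rfl

end Chart

end Literature.Geometry.Kaehler
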